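import Summits.MatrixMultiplication.MatrixMultiplication.Theses.SemilatticeSTPP

/-!
# `SemilatticeSTPP.Thesis` (crux stmt-MatrixMultiplication-5969): packing bounds, the volume floor
# `Σ (aᵢbᵢcᵢ)^{2/3} ≤ |M|`, and the two boundary values ε = 0 (false) / ε = 2 (true)

Refuter lane (`Theorems/Thesis/Negative/`), sorry-free, Mathlib + route file only; no theorem here asserts a
Theses decl positively.

* `gamma_injective_of_tpp`, `alpha_injective_of_tpp`, `beta_injective_of_tpp` — the iff-form of the
  monoid-TPP condition (verbatim the one in `Thesis`, `IdempotentVolumeBeat`, `IdempotentPacking`,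
  `BooleanObstruction`) forces the three coordinate maps to be injective on every block whose third side is
  non-zero, in ANY `Mul` carrier (no associativity, commutativity, regularity or cancellation used).
* `volume_twoThirds_le_card` — hence the packing bounds `Σ aᵢcᵢ, Σ aᵢbᵢ, Σ bᵢcᵢ ≤ |M|` over the
  non-degenerate blocks and, by AM–GM, `Σᵢ (aᵢbᵢcᵢ)^{2/3} ≤ |M|` for every monoid-TPP family in every finite
  `Mul` carrier (BCCGNSU 2017 §2 "packing bound", here without inverses).
* `not_thesisBody_at_zero` — the ∃-body of `Thesis` with `ε = 0` is FALSE for every host: the quantifier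
  `0 < ε` cannot be relaxed to `0 ≤ ε`; the whole content of X_M is the room between exponent 2/3 and (2+ε)/3.
* `thesisBody_at_two` — the ∃-body of `Thesis` at `ε = 2` is TRUE (recovering pair ⟨1,2,1⟩ in ℤ/2:
  `|M| = 2 < 2^{4/3}`), so the body is satisfiable / non-vacuous and the iff-form is read correctly; by
  CKSU05/BCCGNSU17 STPP families in `(ℤ/m)ⁿ` it even holds down to ε ≈ 0.41, and for abelian groups of
  bounded exponent it fails for small ε (BCCGNSU Thm B) — the open range is ε → 0 in hosts with large cyclic
  or idempotent parts.
-/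

set_option linter.dupNamespace false

namespace Summit.MatrixMultiplication.MatrixMultiplication.Theorems.Thesis.Negative.SemilatticeSTPPVolumeFloor

open Finset
open Summit.MatrixMultiplication.MatrixMultiplication.Theses.SemilatticeSTPP

/-- γ is injective on every block with `b > 0`. -/
theorem gamma_injective_of_tpp {M : Type*} [Mul M] {p : ℕ} {a b c : Fin p → ℕ}
    (α : (Σ i, Fin (a i) × Fin (b i)) → M) (β : (Σ i, Fin (b i) × Fin (c i)) → M)
    (γ : (Σ i, Fin (a i) × Fin (c i)) → M)
    (h : ∀ x y z, α x * β y = γ z ↔ (z.1 = x.1 ∧ x.1 = y.1 ∧ (z.2.1 : ℕ) = x.2.1 ∧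
      (x.2.2 : ℕ) = y.2.1 ∧ (z.2.2 : ℕ) = y.2.2))
    (z z' : Σ i, Fin (a i) × Fin (c i)) (hb : 0 < b z.1) (he : γ z = γ z') : z = z' := by
  obtain ⟨i, s, u⟩ := z
  obtain ⟨i', s', u'⟩ := z'
  set t : Fin (b i) := ⟨0, hb⟩
  have hx : α ⟨i, (s, t)⟩ * β ⟨i, (t, u)⟩ = γ ⟨i, (s, u)⟩ := by
    rw [h]; simp
  rw [he, h] at hx
  obtain ⟨h1, -, h3, -, h5⟩ := hx
  simp only at h1 h3 h5
  subst h1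
  simp only [Sigma.mk.injEq, heq_eq_eq, true_and, Prod.mk.injEq]
  exact ⟨Fin.ext h3.symm, Fin.ext h5.symm⟩

/-- α is injective on every block with `c > 0`. -/
theorem alpha_injective_of_tpp {M : Type*} [Mul M] {p : ℕ} {a b c : Fin p → ℕ}
    (α : (Σ i, Fin (a i) × Fin (b i)) → M) (β : (Σ i, Fin (b i) × Fin (c i)) → M)
    (γ : (Σ i, Fin (a i) × Fin (c i)) → M)
    (h : ∀ x y z, α x * β y = γ z ↔ (z.1 = x.1 ∧ x.1 = y.1 ∧ (z.2.1 : ℕ) = x.2.1 ∧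
      (x.2.2 : ℕ) = y.2.1 ∧ (z.2.2 : ℕ) = y.2.2))
    (x x' : Σ i, Fin (a i) × Fin (b i)) (hc : 0 < c x.1) (he : α x = α x') : x = x' := by
  obtain ⟨i, s, t⟩ := x
  obtain ⟨i', s', t'⟩ := x'
  set u : Fin (c i) := ⟨0, hc⟩
  have hx : α ⟨i, (s, t)⟩ * β ⟨i, (t, u)⟩ = γ ⟨i, (s, u)⟩ := by
    rw [h]; simp
  rw [he, h] at hx
  obtain ⟨h1, -, h3, h4, -⟩ := hx
  simp only at h1 h3 h4
  subst h1
  simp only [Sigma.mk.injEq, heq_eq_eq, true_and, Prod.mk.injEq]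
  exact ⟨Fin.ext h3, Fin.ext h4.symm⟩

/-- β is injective on every block with `a > 0`. -/
theorem beta_injective_of_tpp {M : Type*} [Mul M] {p : ℕ} {a b c : Fin p → ℕ}
    (α : (Σ i, Fin (a i) × Fin (b i)) → M) (β : (Σ i, Fin (b i) × Fin (c i)) → M)
    (γ : (Σ i, Fin (a i) × Fin (c i)) → M)
    (h : ∀ x y z, α x * β y = γ z ↔ (z.1 = x.1 ∧ x.1 = y.1 ∧ (z.2.1 : ℕ) = x.2.1 ∧
      (x.2.2 : ℕ) = y.2.1 ∧ (z.2.2 : ℕ) = y.2.2))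
    (y y' : Σ i, Fin (b i) × Fin (c i)) (ha : 0 < a y.1) (he : β y = β y') : y = y' := by
  obtain ⟨j, t, u⟩ := y
  obtain ⟨j', t', u'⟩ := y'
  set s : Fin (a j) := ⟨0, ha⟩
  have hx : α ⟨j, (s, t)⟩ * β ⟨j, (t, u)⟩ = γ ⟨j, (s, u)⟩ := by
    rw [h]; simp
  rw [he, h] at hx
  obtain ⟨-, h2, -, h4, h5⟩ := hx
  simp only at h2 h4 h5
  subst h2
  simp only [Sigma.mk.injEq, heq_eq_eq, true_and, Prod.mk.injEq]
  exact ⟨Fin.ext h4, Fin.ext h5⟩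

/-- AM–GM in the form used for the volume floor: `(abc)^{2/3} ≤ (ab + bc + ac)/3`. -/
theorem rpow_twoThirds_le_arith (a b c : ℕ) :
    ((a * b * c : ℕ) : ℝ) ^ ((2:ℝ) / 3) ≤
      (((a * b : ℕ) : ℝ) + ((b * c : ℕ) : ℝ) + ((a * c : ℕ) : ℝ)) / 3 := by
  have ha : (0:ℝ) ≤ a := Nat.cast_nonneg a
  have hb : (0:ℝ) ≤ b := Nat.cast_nonneg b
  have hc : (0:ℝ) ≤ c := Nat.cast_nonneg c
  have key := Real.geom_mean_le_arith_mean3_weighted (w₁ := 1/3) (w₂ := 1/3) (w₃ := 1/3)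
    (p₁ := (a:ℝ) * b) (p₂ := (b:ℝ) * c) (p₃ := (a:ℝ) * c) (by norm_num) (by norm_num) (by norm_num)
    (by positivity) (by positivity) (by positivity) (by norm_num)
  have lhs : ((a:ℝ) * b) ^ ((1:ℝ) / 3) * ((b:ℝ) * c) ^ ((1:ℝ) / 3) * ((a:ℝ) * c) ^ ((1:ℝ) / 3)
      = ((a:ℝ) * b * c) ^ ((2:ℝ) / 3) := by
    rw [← Real.mul_rpow (by positivity) (by positivity),
      ← Real.mul_rpow (by positivity) (by positivity)]
    have e : (a:ℝ) * b * (b * c) * (a * c) = ((a:ℝ) * b * c) ^ (2:ℝ) := by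
      rw [Real.rpow_two]; ring
    rw [e, ← Real.rpow_mul (by positivity)]
    norm_num
  push_cast
  rw [← lhs]
  linarith [key]

/-- THE VOLUME FLOOR.  For every monoid-TPP family (iff-form) in any finite `Mul` carrier,
`Σᵢ (aᵢbᵢcᵢ)^{2/3} ≤ |M|`: exponent 2/3 can never be beaten, so every witness of `Thesis` lives in the
window `Σ (abc)^{2/3} ≤ |M| < Σ (abc)^{(2+ε)/3}`. -/
theorem volume_twoThirds_le_card {M : Type*} [Mul M] [Fintype M] {p : ℕ} {a b c : Fin p → ℕ}
    (α : (Σ i, Fin (a i) × Fin (b i)) → M) (β : (Σ i, Fin (b i) × Fin (c i)) → M)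
    (γ : (Σ i, Fin (a i) × Fin (c i)) → M)
    (h : ∀ x y z, α x * β y = γ z ↔ (z.1 = x.1 ∧ x.1 = y.1 ∧ (z.2.1 : ℕ) = x.2.1 ∧
      (x.2.2 : ℕ) = y.2.1 ∧ (z.2.2 : ℕ) = y.2.2)) :
    ∑ i, ((a i * b i * c i : ℕ) : ℝ) ^ ((2:ℝ) / 3) ≤ Fintype.card M := by
  classical
  set S : Finset (Fin p) := Finset.univ.filter (fun i => 0 < a i ∧ 0 < b i ∧ 0 < c i) with hS
  -- (1) degenerate blocks contribute nothing
  have hzero : ∀ i ∉ S, ((a i * b i * c i : ℕ) : ℝ) ^ ((2:ℝ) / 3) = 0 := by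
    intro i hi
    have h0 : a i * b i * c i = 0 := by
      simp only [hS, Finset.mem_filter, Finset.mem_univ, true_and, not_and_or, not_lt,
        Nat.le_zero] at hi
      rcases hi with h0 | h0 | h0 <;> simp [h0]
    rw [h0, Nat.cast_zero, Real.zero_rpow (by norm_num)]
  have hsum : ∑ i, ((a i * b i * c i : ℕ) : ℝ) ^ ((2:ℝ) / 3)
      = ∑ i ∈ S, ((a i * b i * c i : ℕ) : ℝ) ^ ((2:ℝ) / 3) := by
    rw [← Finset.sum_subset (Finset.subset_univ S)]
    intro i _ hi
    exact hzero i hi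
  -- (2) the three packing bounds over the non-degenerate blocks
  have hac : ∑ i ∈ S, a i * c i ≤ Fintype.card M := by
    let φ : (Σ i : S, Fin (a i) × Fin (c i)) → M := fun w => γ ⟨w.1.1, w.2⟩
    have hφ : Function.Injective φ := by
      rintro ⟨⟨i, hi⟩, su⟩ ⟨⟨i', hi'⟩, su'⟩ he
      have hb : 0 < b i := ((Finset.mem_filter.mp hi).2).2.1
      have key := gamma_injective_of_tpp α β γ h ⟨i, su⟩ ⟨i', su'⟩ hb he
      obtain ⟨rfl, h2⟩ := Sigma.mk.inj_iff.mp key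
      cases h2
      rfl
    have hcard : Fintype.card (Σ i : S, Fin (a i) × Fin (c i)) = ∑ i ∈ S, a i * c i := by
      rw [Fintype.card_sigma, ← Finset.sum_coe_sort S (fun i => a i * c i)]
      simp only [Fintype.card_prod, Fintype.card_fin]
    rw [← hcard]
    exact Fintype.card_le_of_injective φ hφ
  have hab : ∑ i ∈ S, a i * b i ≤ Fintype.card M := by
    let φ : (Σ i : S, Fin (a i) × Fin (b i)) → M := fun w => α ⟨w.1.1, w.2⟩
    have hφ : Function.Injective φ := by
      rintro ⟨⟨i, hi⟩, st⟩ ⟨⟨i', hi'⟩, st'⟩ he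
      have hc : 0 < c i := ((Finset.mem_filter.mp hi).2).2.2
      have key := alpha_injective_of_tpp α β γ h ⟨i, st⟩ ⟨i', st'⟩ hc he
      obtain ⟨rfl, h2⟩ := Sigma.mk.inj_iff.mp key
      cases h2
      rfl
    have hcard : Fintype.card (Σ i : S, Fin (a i) × Fin (b i)) = ∑ i ∈ S, a i * b i := by
      rw [Fintype.card_sigma, ← Finset.sum_coe_sort S (fun i => a i * b i)]
      simp only [Fintype.card_prod, Fintype.card_fin]
    rw [← hcard]
    exact Fintype.card_le_of_injective φ hφ
  have hbc : ∑ i ∈ S, b i * c i ≤ Fintype.card M := by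
    let φ : (Σ i : S, Fin (b i) × Fin (c i)) → M := fun w => β ⟨w.1.1, w.2⟩
    have hφ : Function.Injective φ := by
      rintro ⟨⟨i, hi⟩, tu⟩ ⟨⟨i', hi'⟩, tu'⟩ he
      have ha : 0 < a i := ((Finset.mem_filter.mp hi).2).1
      have key := beta_injective_of_tpp α β γ h ⟨i, tu⟩ ⟨i', tu'⟩ ha he
      obtain ⟨rfl, h2⟩ := Sigma.mk.inj_iff.mp key
      cases h2
      rfl
    have hcard : Fintype.card (Σ i : S, Fin (b i) × Fin (c i)) = ∑ i ∈ S, b i * c i := by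
      rw [Fintype.card_sigma, ← Finset.sum_coe_sort S (fun i => b i * c i)]
      simp only [Fintype.card_prod, Fintype.card_fin]
    rw [← hcard]
    exact Fintype.card_le_of_injective φ hφ
  -- (3) assemble with AM–GM
  have hac' : ((∑ i ∈ S, (a i * c i) : ℕ) : ℝ) ≤ Fintype.card M := by exact_mod_cast hac
  have hab' : ((∑ i ∈ S, (a i * b i) : ℕ) : ℝ) ≤ Fintype.card M := by exact_mod_cast hab
  have hbc' : ((∑ i ∈ S, (b i * c i) : ℕ) : ℝ) ≤ Fintype.card M := by exact_mod_cast hbc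
  rw [hsum]
  calc ∑ i ∈ S, ((a i * b i * c i : ℕ) : ℝ) ^ ((2:ℝ) / 3)
      ≤ ∑ i ∈ S, ((((a i * b i : ℕ) : ℝ) + ((b i * c i : ℕ) : ℝ) + ((a i * c i : ℕ) : ℝ)) / 3) :=
        Finset.sum_le_sum (fun i _ => rpow_twoThirds_le_arith (a i) (b i) (c i))
    _ = (((∑ i ∈ S, (a i * b i) : ℕ) : ℝ) + ((∑ i ∈ S, (b i * c i) : ℕ) : ℝ)
          + ((∑ i ∈ S, (a i * c i) : ℕ) : ℝ)) / 3 := by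
        push_cast
        rw [← Finset.sum_div, Finset.sum_add_distrib, Finset.sum_add_distrib]
    _ ≤ ((Fintype.card M : ℝ) + Fintype.card M + Fintype.card M) / 3 := by
        gcongr
    _ = Fintype.card M := by ring

/-- BOUNDARY ε = 0 IS FALSE.  The ∃-body of `SemilatticeSTPP.Thesis` with the exponent `(2 + ε)/3`
taken at `ε = 0` has no witness whatsoever (any host, any family): `0 < ε` in `Thesis` cannot be relaxed
to `0 ≤ ε`.  (At `ε = -2` the body becomes junk-TRUE — `0^0 = 1` lets empty blocks count — so the clean
boundary statement is the one at `ε = 0`.) -/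
theorem not_thesisBody_at_zero : ¬ ∃ (M : Type) (_ : CommMonoid M) (_ : Fintype M),
    (∀ x : M, ∃ y : M, x * y * x = x) ∧ ∃ (p : ℕ) (a b c : Fin p → ℕ)
    (α : (Σ i, Fin (a i) × Fin (b i)) → M) (β : (Σ i, Fin (b i) × Fin (c i)) → M)
    (γ : (Σ i, Fin (a i) × Fin (c i)) → M),
    (∀ x y z, α x * β y = γ z ↔ (z.1 = x.1 ∧ x.1 = y.1 ∧ (z.2.1 : ℕ) = x.2.1 ∧ (x.2.2 : ℕ) = y.2.1 ∧
      (z.2.2 : ℕ) = y.2.2)) ∧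
    (Fintype.card M : ℝ) < ∑ i, ((a i * b i * c i : ℕ) : ℝ) ^ ((2 + (0:ℝ)) / 3) := by
  rintro ⟨M, _, _, -, p, a, b, c, α, β, γ, h, hlt⟩
  have hle := volume_twoThirds_le_card α β γ h
  norm_num at hlt hle
  linarith

/-- BOUNDARY ε = 2 IS TRUE (non-vacuity of the body; read-back check of the iff-form).  Host `ℤ/2`
(written multiplicatively; an abelian group, so commutative with every element regular), one block
⟨a,b,c⟩ = ⟨1,2,1⟩, `α(t) = t`, `β(t) = t`, `γ = 0`: `α(t)·β(t') = γ ⟺ t = t'`, and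
`|M| = 2 < 2^{4/3} = (1·2·1)^{(2+2)/3}`. -/
theorem thesisBody_at_two : ∃ (M : Type) (_ : CommMonoid M) (_ : Fintype M),
    (∀ x : M, ∃ y : M, x * y * x = x) ∧ ∃ (p : ℕ) (a b c : Fin p → ℕ)
    (α : (Σ i, Fin (a i) × Fin (b i)) → M) (β : (Σ i, Fin (b i) × Fin (c i)) → M)
    (γ : (Σ i, Fin (a i) × Fin (c i)) → M),
    (∀ x y z, α x * β y = γ z ↔ (z.1 = x.1 ∧ x.1 = y.1 ∧ (z.2.1 : ℕ) = x.2.1 ∧ (x.2.2 : ℕ) = y.2.1 ∧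
      (z.2.2 : ℕ) = y.2.2)) ∧
    (Fintype.card M : ℝ) < ∑ i, ((a i * b i * c i : ℕ) : ℝ) ^ ((2 + (2:ℝ)) / 3) := by
  refine ⟨Multiplicative (ZMod 2), inferInstance, inferInstance, ?_, 1, fun _ => 1, fun _ => 2,
    fun _ => 1, fun x => Multiplicative.ofAdd ((x.2.2 : ℕ) : ZMod 2),
    fun y => Multiplicative.ofAdd ((y.2.1 : ℕ) : ZMod 2), fun _ => 1, ?_, ?_⟩
  · intro x; exact ⟨x⁻¹, by group⟩
  · decide
  · simp only [Finset.univ_unique, Finset.sum_singleton]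
    norm_num
    have : ((2:ℝ)) ^ (1:ℝ) < (2:ℝ) ^ ((4:ℝ) / 3) :=
      Real.rpow_lt_rpow_of_exponent_lt (by norm_num) (by norm_num)
    simpa using this

end Summit.MatrixMultiplication.MatrixMultiplication.Theorems.Thesis.Negative.SemilatticeSTPPVolumeFloor
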